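import Summits.ResolutionOfSingularities.ResolutionOfSingularities.Theorems.RadicialJungCleanModelsWeakEmbeddedLUAlongCoarsening
import Summits.ResolutionOfSingularities.ResolutionOfSingularities.Theorems.RadicialJungCleanModelsNSRescale
import Summits.ResolutionOfSingularities.ResolutionOfSingularities.Theorems.RadicialJungCleanModelsNSResidueRegularize
import Summits.ResolutionOfSingularities.ResolutionOfSingularities.Theorems.RadicialJungCleanModelsNSBlowupPrescribedRsp
import HarnessLib

/-!
# The PRE-CHAIN NORMAL FORM of the rank-one reduction of `hMono_4` (steps (S1)–(S4) composed)

Route `RadicialJung`, crux `CleanModels` (stmt-ResolutionOfSingularities-15917), registered skeleton `Cruxes/CleanModels/Lines/Sketch.lean`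
rev 35 (sha16 de44649d8f729c3b), stub 7 `stub_cleanModelsDimGEFour`.  Explicit-unit seat `decomp-res-hand-2` g5 (structural hand); memo
`Cruxes/CleanModels/Lines/Sketch-memo-hand2-g5-stubs-5-7.md` §3.  OURS; structural bookkeeping, counted 0; nothing here proves resolution of
singularities in characteristic `p`.

`preChain_normalForm` — for `O < O₁ < K` (a proper coarsening of a valuation of a function field of transcendence degree `≤ 4`), a finitely
generated model `A ⊆ O` and a finite `Z ⊆ A`: a finitely generated `A ⊆ A₅ ⊆ O`, REGULAR at the centre of `ν`, with REGULAR residue ring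
`(A₅)_𝔮 / 𝔭`, whose centre `𝔭` of `ν₁` is `(Y) · A₅` for a finite `Y` with `#Y ≤ dim (A₅)_𝔭`, and in which every non-zero `z ∈ Z` is
`c_z · Y^{γ_z}` with `c_z ∈ A₅` a `ν₁`-unit — exactly the input state of ✓ `chainTransport_of_isRsopPart` / ✓ `absorption_step`.  Composition
of ✓ `weakEmbeddedLU_along_properCoarsening_dimLEFour` (S1, F-02 + F-32) · ✓ `exists_rsp_in_model_of_monomial` (S2) ·
✓ `exists_model_residue_regular_locAtCentre_eq` (S3, F-02 + F-32) · ✓ `exists_mul_centre_subset_span` + ✓ `blowupAlong_rsp_of_centre` (S4).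
[cite: NovacoskiSpivakovsky2014, §3.2] [cite: CossartPiltant2019, Thm. 1.1] [cite: CossartJannsenSaito2020, Cor. 1.5]
-/

noncomputable section

set_option linter.dupNamespace false -- mandated namespace of this single-conjunct summit

open IsLocalRing AlgebraicGeometry CategoryTheory
open Literature.AlgebraicGeometry.Resolution Literature.AlgebraicGeometry.Motives

namespace Summit.ResolutionOfSingularities.ResolutionOfSingularities.Theorems.RadicialJung.CleanModels

variable {k K : Type} [Field k] [Field K] [Algebra k K]

/-- A product of powers over a family, regrouped over the image of the family. [folklore] -/
theorem prod_pow_eq_prod_image_pow {ι α M : Type*} [Fintype ι] [DecidableEq α] [CommMonoid M]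
    (g : ι → α) (f : α → M) (μ : ι → ℕ) :
    ∏ i, f (g i) ^ μ i = ∏ y ∈ Finset.univ.image g, f y ^ (∑ i ∈ Finset.univ.filter (fun i => g i = y), μ i) := by
  symm
  refine Finset.prod_image' (fun i => f (g i) ^ μ i) (fun i _ => ?_)
  rw [← Finset.prod_pow_eq_pow_sum]
  refine Finset.prod_congr rfl fun j hj => ?_
  rw [(Finset.mem_filter.mp hj).2]

/-- **The pre-chain normal form** (steps (S1)–(S4) of the rank-one reduction of `hMono_4`): see the module docstring.
[cite: NovacoskiSpivakovsky2014, §3.2] [cite: CossartPiltant2019, Thm. 1.1] [cite: CossartJannsenSaito2020, Cor. 1.5] -/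
theorem preChain_normalForm (hCP : CossartPiltant2019.{0})
    (hEmb : ∀ (Z : Scheme.{0}) [IsIntegral Z] [IsNoetherian Z], Scheme.IsRegular Z →
      Scheme.IsExcellent Z → ∀ (X : Set Z), IsClosed X → X ≠ Set.univ → topologicalKrullDim X ≤ 2 →
        ∃ (Z' : Scheme.{0}) (π : Z' ⟶ Z), IsProper π ∧ Function.Surjective π.base ∧
          (∃ U : Z.Opens, (U : Set Z) = Xᶜ ∧ IsIso (π ∣_ U)) ∧
          IsStrictNormalCrossingsDivisor Z' (π.base ⁻¹' X))
    (O O₁ : ValuationSubring K) (hO : O ≤ O₁) (hne : O₁ ≠ O) (hO₁ : O₁ ≠ ⊤)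
    (A : Subalgebra k K) (hA : A.toSubring ≤ O.toSubring) (hAfg : A.FG) (hfrac : IsFractionRing A K)
    (hdimA : ringKrullDim A ≤ 4) (Z : Finset K) (hZ : ∀ z ∈ Z, z ∈ A) :
    ∃ (A₅ : Subalgebra k K) (hA₅ : A₅.toSubring ≤ O.toSubring), A ≤ A₅ ∧ A₅.FG ∧
      IsRegularLocalRing (Localization.AtPrime ((maximalIdeal O).comap (Subring.inclusion hA₅))) ∧
      IsRegularLocalRing
        (Localization.AtPrime ((maximalIdeal O).comap (Subring.inclusion hA₅)) ⧸
          ((maximalIdeal O₁).comap (Subring.inclusion (hA₅.trans hO))).map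
            (algebraMap A₅.toSubring (Localization.AtPrime ((maximalIdeal O).comap (Subring.inclusion hA₅))))) ∧
      ∃ Y : Finset A₅.toSubring,
        (maximalIdeal O₁).comap (Subring.inclusion (hA₅.trans hO)) = Ideal.span (Y : Set A₅.toSubring) ∧
        (Y.card : WithBot ℕ∞) ≤ ringKrullDim (Localization.AtPrime ((maximalIdeal O₁).comap (Subring.inclusion (hA₅.trans hO)))) ∧
        ∃ (c : K → A₅.toSubring) (γ : K → A₅.toSubring → ℕ),
          ∀ z ∈ Z, z ≠ 0 → O₁.valuation ((c z : A₅.toSubring) : K) = 1 ∧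
            z = ((c z : A₅.toSubring) : K) * ∏ y ∈ Y, ((y : A₅.toSubring) : K) ^ (γ z y) := by
  classical
  haveI := hfrac
  -- (S1) weak embedded LU along `O₁`
  obtain ⟨A₂, hA₂O, hAA₂, hA₂fg, hreg₁, r, a, ha, hdim₁, hmono⟩ :=
    weakEmbeddedLU_along_properCoarsening_dimLEFour hCP hEmb O O₁ hO hne A hA hAfg hfrac hdimA Z hZ
  have hA₂O₁ : A₂.toSubring ≤ O₁.toSubring := hA₂O.trans hO
  haveI : IsLocalRing (locAtCentre A₂.toSubring O₁) := isLocalRing_locAtCentre hA₂O₁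
  have ha𝔪 : ∀ i, O₁.valuation ((a i : K)) < 1 := fun i =>
    (mem_maximalIdeal_locAtCentre_iff hA₂O₁ (a i)).mp (ha ▸ Ideal.subset_span ⟨i, rfl⟩)
  -- the non-zero part of `Z` and its monomial data
  let Z' : Finset K := Z.filter (fun z => z ≠ 0)
  have hZ'A : ∀ z ∈ Z', z ∈ A₂ := fun z hz => hAA₂ (hZ z (Finset.mem_filter.mp hz).1)
  have hmono' : ∀ z : K, ∃ (v : locAtCentre A₂.toSubring O₁) (μ : Fin r → ℕ), z ∈ Z' →
      IsUnit v ∧ z = (v : K) * ∏ i, ((a i : K)) ^ (μ i) := by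
    intro z
    by_cases hz : z ∈ Z'
    · obtain ⟨hzZ, hz0⟩ := Finset.mem_filter.mp hz
      obtain ⟨v, μ, hv, h⟩ := hmono z hzZ hz0
      exact ⟨v, μ, fun _ => ⟨hv, h⟩⟩
    · exact ⟨1, 0, fun h => absurd h hz⟩
  choose v μ hvμ using hmono'
  -- (S2) rescale into the model
  obtain ⟨A₃, hA₃O, hA₂A₃, hA₃fg, hα₃, y, u, hyu, hyval, c, hc⟩ :=
    exists_rsp_in_model_of_monomial O O₁ hO A₂ hA₂O hA₂fg a ha𝔪 Z' hZ'A v μ (fun z hz => (hvμ z hz).1) (fun z hz => (hvμ z hz).2)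
  have hAA₃ : A ≤ A₃ := hAA₂.trans hA₂A₃
  haveI hfrac₃ : IsFractionRing A₃.toSubring K := isFractionRing_subalgebra_of_le A A₃ hAA₃
  have hdimA₃ : ringKrullDim A₃ ≤ 4 := by rw [ringKrullDim_eq_of_fg_of_le hAfg hA₃fg hAA₃]; exact hdimA
  -- (S3) regularise the residue ring, keeping `R₁`
  obtain ⟨A₄, hA₄O, hA₃A₄, hA₄fg, hα₄, hregQ₄⟩ :=
    exists_model_residue_regular_locAtCentre_eq hCP hEmb O O₁ hO hO₁ A₃ hA₃O hA₃fg hfrac₃ hdimA₃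
  have hAA₄ : A ≤ A₄ := hAA₃.trans hA₃A₄
  have hA₄O₁ : A₄.toSubring ≤ O₁.toSubring := hA₄O.trans hO
  haveI hfrac₄ : IsFractionRing A₄.toSubring K := isFractionRing_subalgebra_of_le A A₄ hAA₄
  have hR₁ : locAtCentre A₄.toSubring O₁ = locAtCentre A₂.toSubring O₁ := by rw [hα₄, hα₃]
  -- (S4) the §3.1 step for the prescribed `y`
  set P₄ := (maximalIdeal O₁).comap (Subring.inclusion hA₄O₁) with hP₄def
  have hmemP₄ : ∀ g : A₄.toSubring, g ∈ P₄ ↔ O₁.valuation (g : K) < 1 := fun g => by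
    rw [hP₄def, Ideal.mem_comap, ValuationSubring.valuation_lt_one_iff]; rfl
  let y₄ : Fin r → A₄.toSubring := fun i => ⟨(y i : K), hA₃A₄ (y i).2⟩
  let Y₄ : Finset A₄.toSubring := Finset.univ.image y₄
  have hY₄P : ∀ yy ∈ Y₄, yy ∈ P₄ := by
    intro yy hyy
    obtain ⟨i, -, rfl⟩ := Finset.mem_image.mp hyy
    exact (hmemP₄ _).mpr (hyval i)
  -- local generation of `P₄` by `y` (from `span (range a) = 𝔪_{R₁}` and `y_i = a_i · u_i`)
  have hloc₄ : ∀ π ∈ P₄, ∃ e ∈ P₄.primeCompl, e * π ∈ Ideal.span (Y₄ : Set A₄.toSubring) := by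
    intro π hπ
    have hπR₁ : (π : K) ∈ locAtCentre A₂.toSubring O₁ := hR₁ ▸ le_locAtCentre _ _ π.2
    have hπ𝔪 : (⟨(π : K), hπR₁⟩ : locAtCentre A₂.toSubring O₁) ∈ maximalIdeal _ :=
      (mem_maximalIdeal_locAtCentre_iff hA₂O₁ _).mpr ((hmemP₄ π).mp hπ)
    rw [← ha, Ideal.mem_span_range_iff_exists_fun] at hπ𝔪
    obtain ⟨ρ, hρ⟩ := hπ𝔪
    -- `ρ i · a i = (ρ i · u i⁻¹) · y i`; write `ρ i · u i⁻¹ = b i / e i` over `A₄`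
    have hcoef : ∀ i, ∃ b e : K, b ∈ A₄ ∧ e ∈ A₄ ∧ O₁.valuation e = 1 ∧
        (ρ i : K) * (a i : K) = b / e * (y i : K) := by
      intro i
      obtain ⟨hui, hyi⟩ := hyu i
      have hmem : ((ρ i * ↑(hui.unit⁻¹) : locAtCentre A₂.toSubring O₁) : K) ∈ locAtCentre A₄.toSubring O₁ := by
        rw [hR₁]; exact (ρ i * ↑(hui.unit⁻¹)).2
      obtain ⟨b, hb, e, he, he1, hbe⟩ := (mem_locAtCentre_iff).mp hmem
      refine ⟨b, e, hb, he, he1, ?_⟩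
      rw [← hbe, hyi, Subring.coe_mul]
      have : ((↑(hui.unit⁻¹) : locAtCentre A₂.toSubring O₁) : K) * (u i : K) = 1 := by
        rw [← Subring.coe_mul, hui.val_inv_mul, Subring.coe_one]
      calc (ρ i : K) * (a i : K) = (ρ i : K) * (a i : K) * (((↑(hui.unit⁻¹) : locAtCentre A₂.toSubring O₁) : K) * (u i : K)) := by
              rw [this, mul_one]
        _ = (ρ i : K) * ((↑(hui.unit⁻¹) : locAtCentre A₂.toSubring O₁) : K) * ((a i : K) * (u i : K)) := by ring
    choose b e hbA heA he1 hbe using hcoef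
    have he0 : ∀ i, e i ≠ 0 := fun i => ne_zero_of_valuation_eq_one (he1 i)
    let E : A₄.toSubring := ⟨∏ i, e i, A₄.prod_mem fun i _ => heA i⟩
    have hE1 : O₁.valuation (E : K) = 1 := by
      change O₁.valuation (∏ i, e i) = 1
      rw [map_prod]; exact Finset.prod_eq_one fun i _ => he1 i
    refine ⟨E, (mem_primeCompl_centre_iff O₁ A₄ hA₄O₁ E).mpr hE1, ?_⟩
    -- `E · π = Σ_i (b i · ∏_{j ≠ i} e j) · y i`
    have hbi : ∀ i, b i * ∏ j ∈ Finset.univ.erase i, e j ∈ A₄ := fun i =>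
      A₄.mul_mem (hbA i) (A₄.prod_mem fun j _ => heA j)
    have hsum : E * π = ∑ i, (⟨_, hbi i⟩ : A₄.toSubring) * y₄ i := by
      apply Subtype.ext
      push_cast
      change (∏ i, e i) * (π : K) = ∑ i, (b i * ∏ j ∈ Finset.univ.erase i, e j) * (y i : K)
      have hπeq : (π : K) = ∑ i, (ρ i : K) * (a i : K) := by
        have := congrArg (fun x : locAtCentre A₂.toSubring O₁ => (x : K)) hρ
        simp only at this
        push_cast at this
        exact this.symm
      rw [hπeq, Finset.mul_sum]
      refine Finset.sum_congr rfl fun i _ => ?_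
      rw [hbe i, ← Finset.mul_prod_erase Finset.univ e (Finset.mem_univ i)]
      have := he0 i
      field_simp
    rw [hsum]
    exact Ideal.sum_mem _ fun i _ => Ideal.mul_mem_left _ _ (Ideal.subset_span (Finset.mem_image.mpr ⟨i, Finset.mem_univ _, rfl⟩))
  obtain ⟨a₀, ha₀P, hamul⟩ := exists_mul_centre_subset_span O₁ A₄ hA₄O₁ hA₄fg Y₄ hloc₄
  -- `#Y₄ ≤ dim (A₄)_𝔭 = dim R₁ = r`
  have hY₄card : (Y₄.card : WithBot ℕ∞) ≤ ringKrullDim (Localization.AtPrime P₄) := by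
    have e1 : Localization.AtPrime P₄ ≃+* locAtCentre A₄.toSubring O₁ := (locAtCentreEquiv hA₄O₁).toRingEquiv
    rw [ringKrullDim_eq_of_ringEquiv e1, hR₁, hdim₁]
    have : Y₄.card ≤ r := le_trans Finset.card_image_le (by rw [Finset.card_univ, Fintype.card_fin])
    exact_mod_cast this
  obtain ⟨A₅, hA₅O, hA₄A₅, hA₅fg, -, hregQ₅, hα₅, ⟨Y₅, hIY₅, hY₅card, hY₅val, hY₅Y, hYY₅⟩, hres₅⟩ :=
    blowupAlong_rsp_of_centre O O₁ hO A₄ hA₄O hA₄fg hfrac₄ hregQ₄ Y₄ hY₄P hY₄card a₀ ha₀P hamul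
  have hA₅O₁ : A₅.toSubring ≤ O₁.toSubring := hA₅O.trans hO
  -- the residue ring of `A₅` is that of `A₄`
  have hregQ₅' : IsRegularLocalRing
      (Localization.AtPrime ((maximalIdeal O).comap (Subring.inclusion hA₅O)) ⧸
        ((maximalIdeal O₁).comap (Subring.inclusion (hA₅O.trans hO))).map
          (algebraMap A₅.toSubring (Localization.AtPrime ((maximalIdeal O).comap (Subring.inclusion hA₅O))))) := by
    obtain ⟨θ, hθ⟩ := exists_centreResidueLift O O₁ hO A₄ hA₄O
    obtain ⟨θ', hθ'⟩ := exists_centreResidueLift O O₁ hO A₅ hA₅O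
    have hrange := range_centreResidueLift_eq O O₁ hO A₄ hA₄O θ hθ A₅ hA₅O hA₄A₅ θ' hθ' hres₅
    obtain ⟨e₁⟩ := nonempty_quotCentre_ringEquiv_range O O₁ hO A₄ hA₄O θ hθ
    obtain ⟨e₂⟩ := nonempty_quotCentre_ringEquiv_range O O₁ hO A₅ hA₅O θ' hθ'
    haveI := hregQ₄
    exact IsRegularLocalRing.of_ringEquiv
      (R := Localization.AtPrime ((maximalIdeal O).comap (Subring.inclusion hA₄O)) ⧸
        ((maximalIdeal O₁).comap (Subring.inclusion (hA₄O.trans hO))).map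
          (algebraMap A₄.toSubring (Localization.AtPrime ((maximalIdeal O).comap (Subring.inclusion hA₄O)))))
      (e₁.trans ((RingEquiv.subringCongr hrange.symm).trans e₂.symm))
  -- the transported family `y₅ i = y i / a₀` and `Y₅ = image y₅`
  have ha₀1 : O₁.valuation ((a₀ : A₄.toSubring) : K) = 1 := (mem_primeCompl_centre_iff O₁ A₄ hA₄O₁ a₀).mp ha₀P
  have ha₀0 : ((a₀ : A₄.toSubring) : K) ≠ 0 := ne_zero_of_valuation_eq_one ha₀1
  have hy₅mem : ∀ i, (y i : K) / ((a₀ : A₄.toSubring) : K) ∈ A₅ := by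
    intro i
    obtain ⟨y', -, hy'⟩ := hYY₅ (y₄ i) (Finset.mem_image.mpr ⟨i, Finset.mem_univ _, rfl⟩)
    rw [← hy']; exact y'.2
  let y₅ : Fin r → A₅.toSubring := fun i => ⟨(y i : K) / ((a₀ : A₄.toSubring) : K), hy₅mem i⟩
  have hY₅eq : Y₅ = Finset.univ.image y₅ := by
    ext yy
    constructor
    · intro hyy
      obtain ⟨y4, hy4, hyy'⟩ := hY₅Y yy hyy
      obtain ⟨i, -, rfl⟩ := Finset.mem_image.mp hy4
      exact Finset.mem_image.mpr ⟨i, Finset.mem_univ _, Subtype.ext hyy'.symm⟩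
    · intro hyy
      obtain ⟨i, -, rfl⟩ := Finset.mem_image.mp hyy
      obtain ⟨y', hy', hy'eq⟩ := hYY₅ (y₄ i) (Finset.mem_image.mpr ⟨i, Finset.mem_univ _, rfl⟩)
      have : y' = y₅ i := Subtype.ext hy'eq
      exact this ▸ hy'
  -- coefficients: `c₅ z = c z · a₀^{|μ z|}`
  let N : K → ℕ := fun z => ∑ i, μ z i
  have hc₅mem : ∀ z, ((c z : K)) * ((a₀ : A₄.toSubring) : K) ^ N z ∈ A₅ := fun z =>
    A₅.mul_mem (hA₄A₅ (hA₃A₄ (c z).2)) (A₅.pow_mem (hA₄A₅ a₀.2) _)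
  let c₅ : K → A₅.toSubring := fun z => ⟨_, hc₅mem z⟩
  let γ : K → A₅.toSubring → ℕ := fun z yy => ∑ i ∈ Finset.univ.filter (fun i => y₅ i = yy), μ z i
  refine ⟨A₅, hA₅O, hAA₄.trans hA₄A₅, hA₅fg, hregQ₅, hregQ₅', Y₅, hIY₅, hY₅card, c₅, γ, fun z hzZ hz0 => ?_⟩
  have hzZ' : z ∈ Z' := Finset.mem_filter.mpr ⟨hzZ, hz0⟩
  obtain ⟨hc1, hcz⟩ := hc z hzZ'
  refine ⟨by change O₁.valuation ((c z : K) * ((a₀ : A₄.toSubring) : K) ^ N z) = 1; rw [map_mul, map_pow, hc1, ha₀1, one_pow, mul_one], ?_⟩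
  rw [hY₅eq, ← prod_pow_eq_prod_image_pow y₅ (fun yy : A₅.toSubring => (yy : K)) (μ z)]
  change z = (c z : K) * ((a₀ : A₄.toSubring) : K) ^ (∑ i, μ z i) * ∏ i, ((y i : K) / ((a₀ : A₄.toSubring) : K)) ^ μ z i
  conv_lhs => rw [hcz]
  simp only [div_pow]
  rw [Finset.prod_div_distrib, Finset.prod_pow_eq_pow_sum]
  field_simp

end Summit.ResolutionOfSingularities.ResolutionOfSingularities.Theorems.RadicialJung.CleanModels

end
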